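import Literature.Topology.FourManifolds.PlumbingSphereGeometry
import Literature.Topology.FourManifolds.GluingConstructionMaps
import Literature.Topology.FourManifolds.HomotopySpheresE8PlumbingReduction
import Literature.Topology.FourManifolds.SphereProductTube
import HarnessLib

/-!
# The `E₈` plumbing of eight tubes of the diagonal of `Sᵏ × Sᵏ` as a smooth `2k`-manifold

Topic `Literature/Topology/FourManifolds`; second file of the construction of Kosinski's
`M(4m)` (A. Kosinski, *Differential Manifolds* (1993), VI.12, pp. 119–122), fact seat of
`Literature.Topology.FourManifolds.HomotopySphere.exists_intersectionForm_equivalent_e8Form`.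

Kosinski builds `M(4n)` by attaching eight `2n`-handles to `D⁴ⁿ` along the `E₈` tree, each
presentation sphere having normal bundle `τ(S²ⁿ)`; equivalently (VI.12 p. 120, "the first handle
with the second handle attached to it is again a disc bundle … plumbing") by **plumbing eight
copies of the tangent disc bundle of `S²ⁿ` along the `E₈` tree**. Here the OPEN plumbing is
constructed as a boundaryless smooth manifold (the compact `M(4m)` is cut out of it as a regular
sublevel set in the sequel): the disc bundle of `TSᵏ` is the open tube
`N = {(p, q) ∈ Sᵏ × Sᵏ | ⟪p, q⟫ > c}` of the diagonal (Milnor–Stasheff 1974, Lemma 11.5), and two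
tubes are plumbed at a pole `e` by the involution `Plumbing.plumbMap e` of
`PlumbingSphereGeometry.lean` on `D_e(c) = {⟪p, e⟫ > c, ⟪p, q⟫ > c}` (Kosinski's
`(x, y) ↦ (y, x)`).

* `Plumbing.Tb k c` — the tube as an open submanifold of `Sᵏ × Sᵏ`;
* `Plumbing.Quad X = (X ⊕ X) ⊕ (X ⊕ X)` with `Quad.mk : Fin 4 → X → Quad X`, `Quad.idx`,
  `Quad.pt` — four disjoint copies (Mathlib's disjoint-union manifolds), and the smoothness
  criterion `Quad.contMDiffAt_mk_iff`;
* the `E₈` tree in the bipartite form used for a ONE-SHOT gluing: `A`-summand `a ↔` vertex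
  `2a` (Kosinski's `Σ₁, Σ₃, Σ₅, Σ₇`), `B`-summand `b ↔` vertex `2b + 1` (`Σ₂, Σ₄, Σ₆, Σ₈`); every
  edge of the tree joins the two classes; the edges are properly 3-coloured
  (`Plumbing.edgeA/edgeB/nbA/nbB`, colours = poles `Plumbing.pole k : Fin 3 → Sᵏ`, the first
  three standard basis vectors), so that the plumbing domains used at one vertex are pairwise
  disjoint (`c² ≥ 1/2`, Bessel's inequality);
* `Plumbing.glueData` — the `SmoothGlueData` (tree file `GluingConstruction.lean`) gluing
  `A = Quad N` to `B = Quad N` along the seven plumbing maps; its graph is closed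
  (`isClosed_graph`), so the glued space is Hausdorff;
* **`Plumbing.PV k c`** — the open `E₈` plumbing: a Hausdorff, second countable `C^∞` manifold
  modelled on `ℝᵏ⁺ᵏ`, with the eight open smooth embeddings `Plumbing.ι v : N → PV`
  (`v : Fin 8`, Kosinski's numbering `Σ_{v+1}`), the identification rule `ι_eq_ι_iff`
  (`ι v x = ι w y` iff `v = w ∧ x = y`, or `{v, w}` is an edge of the `E₈` tree — i.e.
  `kosinskiGamma8 v w = 1` — and `y = plumbMap e_{vw} x` on `D_{e_{vw}}(c)`), the covering
  `iUnion_range_ι`, and the smoothness criterion for maps out of `PV` (`contMDiff_iff_comp_ι`).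

Everything is proved; no named facts (D-0026).

## References

* A. Kosinski, *Differential Manifolds*, Academic Press 1993, VI.11–12, pp. 115–122 (plumbing;
  `M(4n)`; the `E₈` tree and `Γ₈` on p. 122). [Kosinski1993]
* J. Milnor, J. Stasheff, *Characteristic classes* (1974), §11 Lemma 11.5. [MilnorStasheff1974]
* W. Browder, *Surgery on simply-connected manifolds* (1972), V §2 (plumbing). [Browder1972]
-/

open scoped Manifold ContDiff Topology RealInnerProductSpace
open Set Function Module

noncomputable section

namespace Literature.Topology.FourManifolds

namespace Plumbing

universe u

/-- Local notation: `𝔼 n` is the model Euclidean space `EuclideanSpace ℝ (Fin n)`. -/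
local notation "𝔼 " n:arg => EuclideanSpace ℝ (Fin n)

/-- Local notation: `𝕊 n` is the unit sphere in `EuclideanSpace ℝ (Fin (n + 1))`. -/
local notation "𝕊 " n:arg => (Metric.sphere (0 : EuclideanSpace ℝ (Fin (n + 1))) 1)

/-! ### §1 The tube as an open submanifold of `Sᵏ × Sᵏ` -/

section Tube

variable (k : ℕ) (c : ℝ)

/-- **The open tube** `N_c = {(p, q) ∈ Sᵏ × Sᵏ | ⟪p, q⟫ > c}` of the diagonal, as an open subset
of `Sᵏ × Sᵏ` — the open disc bundle of `TSᵏ` (Milnor–Stasheff 1974, Lemma 11.5).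
[cite: MilnorStasheff1974, §11 Lemma 11.5] -/
def Tb : TopologicalSpace.Opens ((𝕊 k) × (𝕊 k)) :=
  ⟨{pq | c < fibHt pq}, isOpen_lt continuous_const continuous_fibHt⟩

variable {k c}

/-- `mem_Tb` (mem Tb). [folklore] -/
theorem mem_Tb {pq : (𝕊 k) × (𝕊 k)} : pq ∈ Tb k c ↔ c < fibHt pq := Iff.rfl

/-- The fibre height of a point of the tube exceeds `c`. [folklore] -/
theorem lt_fibHt_coe (x : Tb k c) : c < fibHt (x : (𝕊 k) × (𝕊 k)) := x.2

/-- The diagonal point `(p, p)` of the tube (`c < 1`). [folklore] -/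
def diagPt (hc : c < 1) (p : 𝕊 k) : Tb k c :=
  ⟨(p, p), by
    change c < fibHt (p, p)
    rw [fibHt_apply, real_inner_self_eq_norm_sq, norm_eq_of_mem_sphere p]; simpa using hc⟩

/-- `coe_diagPt` (coe diagPt). [folklore] -/
@[simp] theorem coe_diagPt (hc : c < 1) (p : 𝕊 k) : (diagPt hc p : (𝕊 k) × (𝕊 k)) = (p, p) := rfl

variable (k) in
/-- **The poles** `e_j ∈ Sᵏ`: the standard basis vectors `e_j = (0, …, 1, …, 0)` (index `j`
taken modulo `k + 1`; for `k ≥ 2` the poles `e₀, e₁, e₂` are pairwise orthogonal). [folklore] -/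
def pole (j : ℕ) : 𝕊 k :=
  ⟨EuclideanSpace.single (Fin.ofNat (k + 1) j) 1, by simp⟩

/-- `coe_pole` (coe pole). [folklore] -/
theorem coe_pole (j : ℕ) : (pole k j : 𝔼 (k + 1)) = EuclideanSpace.single (Fin.ofNat (k + 1) j) 1 := rfl

/-- The tube is nonempty (`c < 1`). [folklore] -/
theorem nonempty_Tb (hc : c < 1) : Nonempty (Tb k c) := ⟨diagPt hc (pole k 0)⟩

end Tube

/-! ### §2 Four disjoint copies of a manifold -/

/-- Four disjoint copies of a type, `(X ⊕ X) ⊕ (X ⊕ X)` (so that Mathlib's disjoint-union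
manifold structures apply). [folklore] -/
abbrev Quad (X : Type u) : Type u := (X ⊕ X) ⊕ (X ⊕ X)

namespace Quad

variable {X : Type u}

/-- The `i`-th copy, `i : Fin 4`. [folklore] -/
def mk (i : Fin 4) (x : X) : Quad X :=
  match i with
  | 0 => Sum.inl (Sum.inl x)
  | 1 => Sum.inl (Sum.inr x)
  | 2 => Sum.inr (Sum.inl x)
  | 3 => Sum.inr (Sum.inr x)

/-- The index of the copy a point lies in. [folklore] -/
def idx : Quad X → Fin 4
  | Sum.inl (Sum.inl _) => 0
  | Sum.inl (Sum.inr _) => 1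
  | Sum.inr (Sum.inl _) => 2
  | Sum.inr (Sum.inr _) => 3

/-- The underlying point. [folklore] -/
def pt : Quad X → X
  | Sum.inl (Sum.inl x) => x
  | Sum.inl (Sum.inr x) => x
  | Sum.inr (Sum.inl x) => x
  | Sum.inr (Sum.inr x) => x

/-- `idx_mk` (idx mk). [folklore] -/
@[simp] theorem idx_mk (i : Fin 4) (x : X) : idx (mk i x) = i := by
  fin_cases i <;> rfl

/-- `pt_mk` (pt mk). [folklore] -/
@[simp] theorem pt_mk (i : Fin 4) (x : X) : pt (mk i x) = x := by
  fin_cases i <;> rfl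

/-- `mk_idx_pt` (mk idx pt). [folklore] -/
@[simp] theorem mk_idx_pt (q : Quad X) : mk (idx q) (pt q) = q := by
  rcases q with ((x | x) | (x | x)) <;> rfl

/-- `mk_zero` (mk zero). [folklore] -/
theorem mk_zero (x : X) : mk 0 x = Sum.inl (Sum.inl x) := rfl
/-- `mk_one` (mk one). [folklore] -/
theorem mk_one (x : X) : mk 1 x = Sum.inl (Sum.inr x) := rfl
/-- `mk_two` (mk two). [folklore] -/
theorem mk_two (x : X) : mk 2 x = Sum.inr (Sum.inl x) := rfl
/-- `mk_three` (mk three). [folklore] -/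
theorem mk_three (x : X) : mk 3 x = Sum.inr (Sum.inr x) := rfl

/-- Every point is `mk i x`. [folklore] -/
theorem exists_eq_mk (q : Quad X) : ∃ i x, q = mk i x := ⟨idx q, pt q, (mk_idx_pt q).symm⟩

/-- `mk i x = mk j y ↔ i = j ∧ x = y`. [folklore] -/
theorem mk_eq_mk_iff {i j : Fin 4} {x y : X} : mk i x = mk j y ↔ i = j ∧ x = y := by
  constructor
  · intro h
    have hi : i = j := by simpa using congrArg idx h
    have hx : x = y := by simpa using congrArg pt h
    exact ⟨hi, hx⟩
  · rintro ⟨rfl, rfl⟩; rfl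

/-- `mk_injective` (mk injective). [folklore] -/
theorem mk_injective (i : Fin 4) : Injective (mk i : X → Quad X) := fun _ _ h =>
  (mk_eq_mk_iff.1 h).2

/-- The range of `mk i` is the `i`-th copy. [folklore] -/
theorem range_mk (i : Fin 4) : range (mk i : X → Quad X) = {q | idx q = i} := by
  ext q
  constructor
  · rintro ⟨x, rfl⟩; exact idx_mk i x
  · intro h; exact ⟨pt q, by rw [← h, mk_idx_pt]⟩

/-- `preimage_mk_image_mk_of_ne` (preimage mk image mk of ne). [folklore] -/
theorem preimage_mk_image_mk_of_ne {i j : Fin 4} (hij : i ≠ j) (s : Set X) :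
    mk i ⁻¹' (mk j '' s) = ∅ := by
  ext x
  simp only [mem_preimage, mem_image, mem_empty_iff_false, iff_false, not_exists, not_and]
  intro y _ h
  exact hij (mk_eq_mk_iff.1 h).1.symm

/-- `preimage_mk_image_mk_self` (preimage mk image mk self). [folklore] -/
theorem preimage_mk_image_mk_self (i : Fin 4) (s : Set X) : mk i ⁻¹' (mk i '' s) = s :=
  (mk_injective i).preimage_image s

section Topology

variable [TopologicalSpace X]

/-- `continuous_mk` (continuous mk). [folklore] -/
theorem continuous_mk (i : Fin 4) : Continuous (mk i : X → Quad X) := by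
  fin_cases i
  · exact continuous_inl.comp continuous_inl
  · exact continuous_inl.comp continuous_inr
  · exact continuous_inr.comp continuous_inl
  · exact continuous_inr.comp continuous_inr

/-- `isOpenEmbedding_mk` (isOpenEmbedding mk). [folklore] -/
theorem isOpenEmbedding_mk (i : Fin 4) : Topology.IsOpenEmbedding (mk i : X → Quad X) := by
  fin_cases i
  · exact Topology.IsOpenEmbedding.inl.comp Topology.IsOpenEmbedding.inl
  · exact Topology.IsOpenEmbedding.inl.comp Topology.IsOpenEmbedding.inr
  · exact Topology.IsOpenEmbedding.inr.comp Topology.IsOpenEmbedding.inl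
  · exact Topology.IsOpenEmbedding.inr.comp Topology.IsOpenEmbedding.inr

/-- `isClosedEmbedding_mk` (isClosedEmbedding mk). [folklore] -/
theorem isClosedEmbedding_mk (i : Fin 4) : Topology.IsClosedEmbedding (mk i : X → Quad X) := by
  fin_cases i
  · exact Topology.IsClosedEmbedding.inl.comp Topology.IsClosedEmbedding.inl
  · exact Topology.IsClosedEmbedding.inl.comp Topology.IsClosedEmbedding.inr
  · exact Topology.IsClosedEmbedding.inr.comp Topology.IsClosedEmbedding.inl
  · exact Topology.IsClosedEmbedding.inr.comp Topology.IsClosedEmbedding.inr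

/-- `isOpenMap_mk` (isOpenMap mk). [folklore] -/
theorem isOpenMap_mk (i : Fin 4) : IsOpenMap (mk i : X → Quad X) := (isOpenEmbedding_mk i).isOpenMap

/-- `isOpen_range_mk` (isOpen range mk). [folklore] -/
theorem isOpen_range_mk (i : Fin 4) : IsOpen (range (mk i : X → Quad X)) :=
  (isOpenEmbedding_mk i).isOpen_range

/-- `pt` is continuous. [folklore] -/
theorem continuous_pt : Continuous (pt : Quad X → X) := by
  have h : (pt : Quad X → X) = Sum.elim (Sum.elim id id) (Sum.elim id id) := by
    ext q; rcases q with ((x | x) | (x | x)) <;> rfl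
  rw [h]
  exact (continuous_id.sumElim continuous_id).sumElim (continuous_id.sumElim continuous_id)

/-- `idx` is locally constant (continuous into the discrete `Fin 4`). [folklore] -/
theorem continuous_idx : Continuous (idx : Quad X → Fin 4) := by
  have h : (idx : Quad X → Fin 4) = Sum.elim (Sum.elim (fun _ => 0) (fun _ => 1))
      (Sum.elim (fun _ => 2) (fun _ => 3)) := by
    ext q; rcases q with ((x | x) | (x | x)) <;> rfl
  rw [h]
  exact (continuous_const.sumElim continuous_const).sumElim (continuous_const.sumElim continuous_const)

/-- A set is open iff its traces on the four copies are. [folklore] -/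
theorem isOpen_iff {s : Set (Quad X)} : IsOpen s ↔ ∀ i, IsOpen (mk i ⁻¹' s) := by
  constructor
  · intro hs i; exact hs.preimage (continuous_mk i)
  · intro h
    rw [isOpen_sum_iff, isOpen_sum_iff, isOpen_sum_iff]
    exact ⟨⟨h 0, h 1⟩, ⟨h 2, h 3⟩⟩

end Topology

/-- Near `mk i x`, every map factors through the `i`-th copy: `F = (F ∘ mk i) ∘ pt` on
`range (mk i)`. [folklore] -/
theorem eqOn_comp_mk_pt {Y : Type*} (F : Quad X → Y) (i : Fin 4) :
    EqOn F ((F ∘ mk i) ∘ pt) (range (mk i)) := by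
  rintro _ ⟨x, rfl⟩
  simp

section Smooth

variable {EX HX : Type*} [NormedAddCommGroup EX] [NormedSpace ℝ EX] [TopologicalSpace HX]
  {IX : ModelWithCorners ℝ EX HX} [TopologicalSpace X] [ChartedSpace HX X]
  {EY HY : Type*} [NormedAddCommGroup EY] [NormedSpace ℝ EY] [TopologicalSpace HY]
  {IY : ModelWithCorners ℝ EY HY} {Y : Type*} [TopologicalSpace Y] [ChartedSpace HY Y]
  {n : WithTop ℕ∞}

/-- `mk i` is smooth (Mathlib: the summand inclusions of a disjoint union of manifolds are smooth).
[folklore] -/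
theorem contMDiff_mk (i : Fin 4) : ContMDiff IX IX n (mk i : X → Quad X) := by
  fin_cases i
  · exact ContMDiff.inl.comp ContMDiff.inl
  · exact ContMDiff.inl.comp ContMDiff.inr
  · exact ContMDiff.inr.comp ContMDiff.inl
  · exact ContMDiff.inr.comp ContMDiff.inr

/-- `pt` is smooth. [folklore] -/
theorem contMDiff_pt : ContMDiff IX IX n (pt : Quad X → X) := by
  have h : (pt : Quad X → X) = Sum.elim (Sum.elim id id) (Sum.elim id id) := by
    ext q; rcases q with ((x | x) | (x | x)) <;> rfl
  rw [h]
  exact (contMDiff_id.sumElim contMDiff_id).sumElim (contMDiff_id.sumElim contMDiff_id)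

/-- **Smoothness at a point of the `i`-th copy is smoothness of the restriction to that copy.**
[folklore] -/
theorem contMDiffAt_mk_iff {F : Quad X → Y} {i : Fin 4} {x : X} :
    ContMDiffAt IX IY n F (mk i x) ↔ ContMDiffAt IX IY n (F ∘ mk i) x := by
  constructor
  · intro h; exact h.comp x (contMDiff_mk i).contMDiffAt
  · intro h
    have h2 : ContMDiffAt IX IY n ((F ∘ mk i) ∘ pt) (mk i x) := by
      apply ContMDiffAt.comp (mk i x) _ contMDiff_pt.contMDiffAt
      simpa using h
    refine h2.congr_of_eventuallyEq ?_
    filter_upwards [(isOpen_range_mk i).mem_nhds (mem_range_self x)] with q hq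
    exact eqOn_comp_mk_pt F i hq

/-- A map out of `Quad X` is smooth iff its four restrictions are. [folklore] -/
theorem contMDiff_iff_comp_mk {F : Quad X → Y} :
    ContMDiff IX IY n F ↔ ∀ i, ContMDiff IX IY n (F ∘ mk i) := by
  constructor
  · intro h i; exact h.comp (contMDiff_mk i)
  · intro h q
    obtain ⟨i, x, rfl⟩ := exists_eq_mk q
    exact contMDiffAt_mk_iff.2 (h i x)

/-- A map out of `Quad X` is smooth on an open set iff its restrictions are smooth on the traces.
[folklore] -/
theorem contMDiffOn_of_comp_mk {F : Quad X → Y} {s : Set (Quad X)} (hs : IsOpen s)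
    (h : ∀ i, ContMDiffOn IX IY n (F ∘ mk i) (mk i ⁻¹' s)) : ContMDiffOn IX IY n F s := by
  intro q hq
  obtain ⟨i, x, rfl⟩ := exists_eq_mk q
  have hx : x ∈ mk i ⁻¹' s := hq
  have h1 : ContMDiffAt IX IY n (F ∘ mk i) x :=
    (h i x hx).contMDiffAt ((hs.preimage (continuous_mk i)).mem_nhds hx)
  exact (contMDiffAt_mk_iff.2 h1).contMDiffWithinAt

end Smooth

end Quad

/-! ### §3 The `E₈` tree: bipartition and a proper 3-colouring of its edges -/

section Tree

/-- The vertex `2a` of the `E₈` tree (Kosinski's `Σ₁, Σ₃, Σ₅, Σ₇` for `a = 0, 1, 2, 3`): the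
`a`-th summand of the `A`-side of the gluing. [cite: Kosinski1993, VI.12 p. 122] -/
def vA (a : Fin 4) : Fin 8 := ⟨2 * a.val, by omega⟩

/-- The vertex `2b + 1` of the `E₈` tree (Kosinski's `Σ₂, Σ₄, Σ₆, Σ₈`): the `b`-th summand of the
`B`-side. [cite: Kosinski1993, VI.12 p. 122] -/
def vB (b : Fin 4) : Fin 8 := ⟨2 * b.val + 1, by omega⟩

/-- Every vertex is on the `A`-side or on the `B`-side. [folklore] -/
theorem exists_vA_or_vB (v : Fin 8) : (∃ a, v = vA a) ∨ ∃ b, v = vB b := by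
  fin_cases v
  · exact Or.inl ⟨0, rfl⟩
  · exact Or.inr ⟨0, rfl⟩
  · exact Or.inl ⟨1, rfl⟩
  · exact Or.inr ⟨1, rfl⟩
  · exact Or.inl ⟨2, rfl⟩
  · exact Or.inr ⟨2, rfl⟩
  · exact Or.inl ⟨3, rfl⟩
  · exact Or.inr ⟨3, rfl⟩

/-- `vA_injective` (vA injective). [folklore] -/
theorem vA_injective : Injective vA := by
  intro a a' h; fin_cases a <;> fin_cases a' <;> simp_all [vA]

/-- `vB_injective` (vB injective). [folklore] -/
theorem vB_injective : Injective vB := by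
  intro b b' h; fin_cases b <;> fin_cases b' <;> simp_all [vB]

/-- `vA_ne_vB` (vA ne vB). [folklore] -/
theorem vA_ne_vB (a b : Fin 4) : vA a ≠ vB b := by
  fin_cases a <;> fin_cases b <;> simp [vA, vB]

/-- **The colour (pole index) of a pair of vertices**: `2` for the edge `{Σ₅, Σ₈}`, otherwise the
parity of the smaller index — on the seven edges `Σ₁–Σ₂, …, Σ₆–Σ₇, Σ₅–Σ₈` of the tree this is a
proper edge 3-colouring (`0, 1, 0, 1, 0, 1` along the path and `2` on the branch). [folklore] -/
def ecol (v w : Fin 8) : Fin 3 :=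
  if min v.val w.val = 4 ∧ max v.val w.val = 7 then 2 else ⟨(min v.val w.val) % 2, by omega⟩

/-- `ecol_comm` (ecol comm). [folklore] -/
theorem ecol_comm (v w : Fin 8) : ecol v w = ecol w v := by
  simp only [ecol, min_comm, max_comm]

/-- There is an edge of colour `j` at the `A`-vertex `2a`. [folklore] -/
def edgeA (a : Fin 4) (j : Fin 3) : Prop := (j = 0 ∧ a ≠ 3) ∨ (j = 1 ∧ a ≠ 0) ∨ (j = 2 ∧ a = 2)

/-- There is an edge of colour `j` at the `B`-vertex `2b + 1`. [folklore] -/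
def edgeB (b : Fin 4) (j : Fin 3) : Prop := (j = 0 ∧ b ≠ 3) ∨ (j = 1 ∧ b ≠ 3) ∨ (j = 2 ∧ b = 3)

/-- `instance` (instance). [folklore] -/
instance (a : Fin 4) (j : Fin 3) : Decidable (edgeA a j) := by unfold edgeA; infer_instance
/-- `instance` (instance). [folklore] -/
instance (b : Fin 4) (j : Fin 3) : Decidable (edgeB b j) := by unfold edgeB; infer_instance

/-- The `B`-neighbour along the edge of colour `j` at the `A`-vertex `2a` (junk if there is none).
[folklore] -/
def nbA (a : Fin 4) (j : Fin 3) : Fin 4 := if j = 0 then a else if j = 1 then a - 1 else 3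

/-- The `A`-neighbour along the edge of colour `j` at the `B`-vertex `2b + 1` (junk if none).
[folklore] -/
def nbB (b : Fin 4) (j : Fin 3) : Fin 4 := if j = 0 then b else if j = 1 then b + 1 else 2

/-- `edgeB_nbA` (edgeB nbA). [folklore] -/
theorem edgeB_nbA : ∀ (a : Fin 4) (j : Fin 3), edgeA a j → edgeB (nbA a j) j := by decide
/-- `edgeA_nbB` (edgeA nbB). [folklore] -/
theorem edgeA_nbB : ∀ (b : Fin 4) (j : Fin 3), edgeB b j → edgeA (nbB b j) j := by decide
/-- `nbB_nbA` (nbB nbA). [folklore] -/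
theorem nbB_nbA : ∀ (a : Fin 4) (j : Fin 3), edgeA a j → nbB (nbA a j) j = a := by decide
/-- `nbA_nbB` (nbA nbB). [folklore] -/
theorem nbA_nbB : ∀ (b : Fin 4) (j : Fin 3), edgeB b j → nbA (nbB b j) j = b := by decide

/-- **The edges of the `E₈` tree join the two sides, one per colour**: `Γ₈(2a, 2b+1) = 1` iff
`b` is the neighbour of `a` along an edge of some colour. [cite: Kosinski1993, VI.12 p. 122 (the matrix Γ₈)] -/
theorem gamma8_vA_vB_eq_one_iff : ∀ (a b : Fin 4),
    kosinskiGamma8 (vA a) (vB b) = 1 ↔ ∃ j : Fin 3, edgeA a j ∧ nbA a j = b := by decide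

/-- `gamma8_vB_vA` (gamma8 vB vA). [folklore] -/
theorem gamma8_vB_vA (a b : Fin 4) : kosinskiGamma8 (vB b) (vA a) = kosinskiGamma8 (vA a) (vB b) := by
  fin_cases a <;> fin_cases b <;> decide

/-- No edge joins two `A`-vertices. [cite: Kosinski1993, VI.12 p. 122 (the matrix Γ₈)] -/
theorem gamma8_vA_vA_ne_one : ∀ (a a' : Fin 4), kosinskiGamma8 (vA a) (vA a') ≠ 1 := by decide

/-- No edge joins two `B`-vertices. [cite: Kosinski1993, VI.12 p. 122 (the matrix Γ₈)] -/
theorem gamma8_vB_vB_ne_one : ∀ (b b' : Fin 4), kosinskiGamma8 (vB b) (vB b') ≠ 1 := by decide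

/-- The colour of the edge of colour `j` is `j`. [folklore] -/
theorem ecol_vA_nbA : ∀ (a : Fin 4) (j : Fin 3), edgeA a j → ecol (vA a) (vB (nbA a j)) = j := by
  decide

/-- At a vertex, distinct colours lead to distinct neighbours. [folklore] -/
theorem nbA_injective_of_edge : ∀ (a : Fin 4) (j j' : Fin 3), edgeA a j → edgeA a j' →
    nbA a j = nbA a j' → j = j' := by decide

/-- `nbB_injective_of_edge` (nbB injective of edge). [folklore] -/
theorem nbB_injective_of_edge : ∀ (b : Fin 4) (j j' : Fin 3), edgeB b j → edgeB b j' →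
    nbB b j = nbB b j' → j = j' := by decide

end Tree

/-! ### §4 Poles and the disjointness of the plumbing domains at one vertex -/

section Poles

variable {k : ℕ}

/-- For `j < k + 1` the pole `e_j` is the `j`-th standard basis vector. [folklore] -/
theorem coe_pole_of_lt {j : ℕ} (hj : j < k + 1) :
    (pole k j : 𝔼 (k + 1)) = EuclideanSpace.single (⟨j, hj⟩ : Fin (k + 1)) 1 := by
  rw [coe_pole]
  congr 2
  exact Fin.ext (Nat.mod_eq_of_lt hj)

/-- **The poles `e₀, e₁, e₂` are pairwise orthogonal** (`k ≥ 2`). [folklore] -/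
theorem inner_pole_pole_of_ne (hk : 2 ≤ k) {i j : Fin 3} (hij : i ≠ j) :
    ⟪(pole k i.val : 𝔼 (k + 1)), (pole k j.val : 𝔼 (k + 1))⟫ = 0 := by
  have hi : i.val < k + 1 := by omega
  have hj : j.val < k + 1 := by omega
  rw [coe_pole_of_lt hi, coe_pole_of_lt hj, EuclideanSpace.inner_single_left]
  have : (⟨j.val, hj⟩ : Fin (k + 1)) ≠ ⟨i.val, hi⟩ := fun h =>
    hij (Fin.ext (by simpa using (congrArg Fin.val h).symm))
  simp [this]

/-- **Bessel for two orthogonal unit vectors**: `⟪p, e⟫² + ⟪p, e'⟫² ≤ ‖p‖²`. [folklore] -/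
theorem sq_inner_add_sq_inner_le {E : Type*} [NormedAddCommGroup E] [InnerProductSpace ℝ E]
    {e e' : E} (he : ‖e‖ = 1) (he' : ‖e'‖ = 1) (hee' : ⟪e, e'⟫ = 0) (p : E) :
    ⟪p, e⟫ ^ 2 + ⟪p, e'⟫ ^ 2 ≤ ‖p‖ ^ 2 := by
  have h0 : 0 ≤ ‖p - ⟪p, e⟫ • e - ⟪p, e'⟫ • e'‖ ^ 2 := sq_nonneg _
  have hexp : ‖p - ⟪p, e⟫ • e - ⟪p, e'⟫ • e'‖ ^ 2 = ‖p‖ ^ 2 - ⟪p, e⟫ ^ 2 - ⟪p, e'⟫ ^ 2 := by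
    rw [← real_inner_self_eq_norm_sq, ← real_inner_self_eq_norm_sq]
    have hee : ⟪e, e⟫ = 1 := by rw [real_inner_self_eq_norm_sq, he, one_pow]
    have hee'' : ⟪e', e'⟫ = 1 := by rw [real_inner_self_eq_norm_sq, he', one_pow]
    simp only [inner_sub_left, inner_sub_right, real_inner_smul_left, real_inner_smul_right, hee,
      hee'', real_inner_comm e p, real_inner_comm e' p, real_inner_comm e e', hee']
    ring
  linarith [h0, hexp]

/-- **Caps of height `c` around orthogonal poles are disjoint when `2c² ≥ 1`, `c ≥ 0`.**
[folklore] -/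
theorem not_lt_inner_and_lt_inner {E : Type*} [NormedAddCommGroup E] [InnerProductSpace ℝ E]
    {e e' p : E} (he : ‖e‖ = 1) (he' : ‖e'‖ = 1) (hee' : ⟪e, e'⟫ = 0) (hp : ‖p‖ = 1) {c : ℝ}
    (hc0 : 0 ≤ c) (hc2 : 1 ≤ 2 * c ^ 2) : ¬ (c < ⟪p, e⟫ ∧ c < ⟪p, e'⟫) := by
  rintro ⟨h1, h2⟩
  have hb := sq_inner_add_sq_inner_le he he' hee' p
  rw [hp, one_pow] at hb
  have h1' : c ^ 2 < ⟪p, e⟫ ^ 2 := by nlinarith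
  have h2' : c ^ 2 < ⟪p, e'⟫ ^ 2 := by nlinarith
  linarith

/-- **Admissible plumbing parameters**: `0 ≤ c < 1` and `2c² ≥ 1` (so `c ≥ 1/√2`: the three
plumbing caps at a vertex are pairwise disjoint). [folklore] -/
structure IsParam (c : ℝ) : Prop where
  nonneg : 0 ≤ c
  lt_one : c < 1
  half_le : 1 ≤ 2 * c ^ 2

/-- `IsParam.neg_one_le` (IsParam.neg one le). [folklore] -/
theorem IsParam.neg_one_le {c : ℝ} (h : IsParam c) : -1 ≤ c := by linarith [h.nonneg]

/-- `IsParam.neg_one_lt` (IsParam.neg one lt). [folklore] -/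
theorem IsParam.neg_one_lt {c : ℝ} (h : IsParam c) : -1 < c := by linarith [h.nonneg]

/-- `c = 3/4` is admissible (`2 · 9/16 = 9/8 ≥ 1`). [folklore] -/
theorem isParam_three_quarters : IsParam (3 / 4 : ℝ) :=
  ⟨by norm_num, by norm_num, by norm_num⟩

variable (k) in
/-- **The plumbing domain of colour `j`**: `D_j = D_{e_j}(c)`. [cite: Kosinski1993, VI.12 p. 120] -/
def dom (c : ℝ) (j : Fin 3) : Set ((𝕊 k) × (𝕊 k)) := plumbDom (pole k j.val) c

/-- `mem_dom` (mem dom). [folklore] -/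
theorem mem_dom {c : ℝ} {j : Fin 3} {pq : (𝕊 k) × (𝕊 k)} :
    pq ∈ dom k c j ↔ c < baseHt (pole k j.val) pq ∧ c < fibHt pq := Iff.rfl

/-- `isOpen_dom` (isOpen dom). [folklore] -/
theorem isOpen_dom (c : ℝ) (j : Fin 3) : IsOpen (dom k c j) := isOpen_plumbDom _ _

/-- **The plumbing domains of distinct colours are disjoint** (`k ≥ 2`, admissible `c`).
[folklore] -/
theorem dom_disjoint (hk : 2 ≤ k) {c : ℝ} (hc : IsParam c) {i j : Fin 3} (hij : i ≠ j)
    {pq : (𝕊 k) × (𝕊 k)} (hi : pq ∈ dom k c i) (hj : pq ∈ dom k c j) : False :=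
  not_lt_inner_and_lt_inner (norm_eq_of_mem_sphere (pole k i.val)) (norm_eq_of_mem_sphere (pole k j.val))
    (inner_pole_pole_of_ne hk hij) (norm_eq_of_mem_sphere pq.1) hc.nonneg hc.half_le ⟨hi.1, hj.1⟩

/-- The plumbing map of colour `j` preserves `D_j`. [cite: Kosinski1993, VI.12 p. 120] -/
theorem mapsTo_plumbMap_dom {c : ℝ} (hc : IsParam c) (j : Fin 3) :
    MapsTo (plumbMap (pole k j.val)) (dom k c j) (dom k c j) :=
  mapsTo_plumbMap _ hc.neg_one_le

end Poles

/-! ### §5 The gluing map `A = Quad N ⇀ B = Quad N` along the seven coloured edges -/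

section Glue

variable {k : ℕ} {c : ℝ}

open Classical in
/-- The plumbing map of colour `j` as a total self-map of the tube (the identity off `D_j`).
[cite: Kosinski1993, VI.12 p. 120] -/
def pm (hc : IsParam c) (j : Fin 3) (x : Tb k c) : Tb k c :=
  if hx : (x : (𝕊 k) × (𝕊 k)) ∈ dom k c j then
    ⟨plumbMap (pole k j.val) x, (mapsTo_plumbMap_dom hc j hx).2⟩
  else x

/-- `coe_pm_of_mem` (coe pm of mem). [folklore] -/
theorem coe_pm_of_mem (hc : IsParam c) {j : Fin 3} {x : Tb k c} (hx : (x : (𝕊 k) × (𝕊 k)) ∈ dom k c j) :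
    (pm hc j x : (𝕊 k) × (𝕊 k)) = plumbMap (pole k j.val) x := by
  rw [pm, dif_pos hx]

/-- `pm_of_not_mem` (pm of not mem). [folklore] -/
theorem pm_of_not_mem (hc : IsParam c) {j : Fin 3} {x : Tb k c} (hx : (x : (𝕊 k) × (𝕊 k)) ∉ dom k c j) :
    pm hc j x = x := by
  rw [pm, dif_neg hx]

/-- `pm_mem_dom` (pm mem dom). [folklore] -/
theorem pm_mem_dom (hc : IsParam c) {j : Fin 3} {x : Tb k c} (hx : (x : (𝕊 k) × (𝕊 k)) ∈ dom k c j) :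
    (pm hc j x : (𝕊 k) × (𝕊 k)) ∈ dom k c j := by
  rw [coe_pm_of_mem hc hx]; exact mapsTo_plumbMap_dom hc j hx

/-- `pm j` is an involution on `D_j`. [folklore] -/
theorem pm_pm (hc : IsParam c) {j : Fin 3} {x : Tb k c} (hx : (x : (𝕊 k) × (𝕊 k)) ∈ dom k c j) :
    pm hc j (pm hc j x) = x := by
  apply Subtype.ext
  rw [coe_pm_of_mem hc (pm_mem_dom hc hx), coe_pm_of_mem hc hx, plumbMap_plumbMap]

/-- `pm j` agrees with `plumbMap e_j ∘ val` on the open set `{x | ↑x ∈ D_j}`. [folklore] -/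
theorem eqOn_coe_pm (hc : IsParam c) (j : Fin 3) :
    EqOn (fun x : Tb k c => (pm hc j x : (𝕊 k) × (𝕊 k))) (fun x => plumbMap (pole k j.val) x)
      {x | (x : (𝕊 k) × (𝕊 k)) ∈ dom k c j} := fun _ hx => coe_pm_of_mem hc hx

/-- `isOpen_setOf_coe_mem_dom` (isOpen setOf coe mem dom). [folklore] -/
theorem isOpen_setOf_coe_mem_dom (j : Fin 3) : IsOpen {x : Tb k c | (x : (𝕊 k) × (𝕊 k)) ∈ dom k c j} :=
  (isOpen_dom c j).preimage continuous_subtype_val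

/-- `pm j` is continuous at the points of `D_j`. [folklore] -/
theorem continuousAt_pm (hc : IsParam c) {j : Fin 3} {x : Tb k c} (hx : (x : (𝕊 k) × (𝕊 k)) ∈ dom k c j) :
    ContinuousAt (pm hc j) x := by
  have hind : Topology.IsInducing (Subtype.val : Tb k c → (𝕊 k) × (𝕊 k)) := Topology.IsInducing.subtypeVal
  rw [hind.continuousAt_iff]
  have hg : ContinuousAt (plumbMap (pole k j.val)) (x : (𝕊 k) × (𝕊 k)) :=
    (continuousOn_plumbMap _).continuousAt
      ((isOpen_plumbDom _ _).mem_nhds ⟨lt_of_le_of_lt hc.neg_one_le hx.1, lt_of_le_of_lt hc.neg_one_le hx.2⟩)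
  have h1 : ContinuousAt (fun y : Tb k c => plumbMap (pole k j.val) (y : (𝕊 k) × (𝕊 k))) x :=
    hg.comp continuous_subtype_val.continuousAt
  refine h1.congr ?_
  filter_upwards [(isOpen_setOf_coe_mem_dom j).mem_nhds hx] with y hy
  exact (coe_pm_of_mem hc hy).symm

/-- `pm j` is smooth at the points of `D_j`. [cite: Kosinski1993, VI.12 p. 120] -/
theorem contMDiffAt_pm (hc : IsParam c) {j : Fin 3} {x : Tb k c} (hx : (x : (𝕊 k) × (𝕊 k)) ∈ dom k c j) :
    ContMDiffAt ((𝓡 k).prod (𝓡 k)) ((𝓡 k).prod (𝓡 k)) ∞ (pm hc j) x := by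
  rw [← ContMDiffAt.subtypeVal_comp_iff (Tb k c) (pm hc j) x]
  have hg : ContMDiffAt ((𝓡 k).prod (𝓡 k)) ((𝓡 k).prod (𝓡 k)) ∞ (plumbMap (pole k j.val))
      (x : (𝕊 k) × (𝕊 k)) :=
    (contMDiffOn_plumbMap _).contMDiffAt
      ((isOpen_plumbDom _ _).mem_nhds ⟨lt_of_le_of_lt hc.neg_one_le hx.1, lt_of_le_of_lt hc.neg_one_le hx.2⟩)
  have h1 : ContMDiffAt ((𝓡 k).prod (𝓡 k)) ((𝓡 k).prod (𝓡 k)) ∞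
      (fun y : Tb k c => plumbMap (pole k j.val) (y : (𝕊 k) × (𝕊 k))) x :=
    hg.comp x contMDiff_subtype_val.contMDiffAt
  refine h1.congr_of_eventuallyEq ?_
  filter_upwards [(isOpen_setOf_coe_mem_dom j).mem_nhds hx] with y hy
  exact coe_pm_of_mem hc hy

open Classical in
/-- **The gluing map `A → B`** on four copies of the tube: a point of the `a`-th copy lying in
`D_j` goes to the copy of the neighbour `nbA a j`, by the plumbing map of colour `j` (at most one
colour applies). [cite: Kosinski1993, VI.12 p. 120] -/
def glueFun (hc : IsParam c) (q : Quad (Tb k c)) : Quad (Tb k c) :=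
  if ((Quad.pt q : Tb k c) : (𝕊 k) × (𝕊 k)) ∈ dom k c 0 then Quad.mk (nbA (Quad.idx q) 0) (pm hc 0 (Quad.pt q))
  else if ((Quad.pt q : Tb k c) : (𝕊 k) × (𝕊 k)) ∈ dom k c 1 then Quad.mk (nbA (Quad.idx q) 1) (pm hc 1 (Quad.pt q))
  else if ((Quad.pt q : Tb k c) : (𝕊 k) × (𝕊 k)) ∈ dom k c 2 then Quad.mk (nbA (Quad.idx q) 2) (pm hc 2 (Quad.pt q))
  else q

open Classical in
/-- **The gluing map `B → A`** (inverse of `glueFun`). [cite: Kosinski1993, VI.12 p. 120] -/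
def unglueFun (hc : IsParam c) (q : Quad (Tb k c)) : Quad (Tb k c) :=
  if ((Quad.pt q : Tb k c) : (𝕊 k) × (𝕊 k)) ∈ dom k c 0 then Quad.mk (nbB (Quad.idx q) 0) (pm hc 0 (Quad.pt q))
  else if ((Quad.pt q : Tb k c) : (𝕊 k) × (𝕊 k)) ∈ dom k c 1 then Quad.mk (nbB (Quad.idx q) 1) (pm hc 1 (Quad.pt q))
  else if ((Quad.pt q : Tb k c) : (𝕊 k) × (𝕊 k)) ∈ dom k c 2 then Quad.mk (nbB (Quad.idx q) 2) (pm hc 2 (Quad.pt q))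
  else q

/-- Value of the gluing map on `D_j`. [folklore] -/
theorem glueFun_eq (hk : 2 ≤ k) (hc : IsParam c) {j : Fin 3} {q : Quad (Tb k c)}
    (hq : ((Quad.pt q : Tb k c) : (𝕊 k) × (𝕊 k)) ∈ dom k c j) :
    glueFun hc q = Quad.mk (nbA (Quad.idx q) j) (pm hc j (Quad.pt q)) := by
  have key : ∀ i, ((Quad.pt q : Tb k c) : (𝕊 k) × (𝕊 k)) ∈ dom k c i → i = j := fun i hi => by
    by_contra hij; exact dom_disjoint hk hc hij hi hq
  unfold glueFun
  split_ifs with h0 h1 h2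
  · obtain rfl := key 0 h0; rfl
  · obtain rfl := key 1 h1; rfl
  · obtain rfl := key 2 h2; rfl
  · exfalso
    fin_cases j
    exacts [h0 hq, h1 hq, h2 hq]

/-- Value of the inverse gluing map on `D_j`. [folklore] -/
theorem unglueFun_eq (hk : 2 ≤ k) (hc : IsParam c) {j : Fin 3} {q : Quad (Tb k c)}
    (hq : ((Quad.pt q : Tb k c) : (𝕊 k) × (𝕊 k)) ∈ dom k c j) :
    unglueFun hc q = Quad.mk (nbB (Quad.idx q) j) (pm hc j (Quad.pt q)) := by
  have key : ∀ i, ((Quad.pt q : Tb k c) : (𝕊 k) × (𝕊 k)) ∈ dom k c i → i = j := fun i hi => by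
    by_contra hij; exact dom_disjoint hk hc hij hi hq
  unfold unglueFun
  split_ifs with h0 h1 h2
  · obtain rfl := key 0 h0; rfl
  · obtain rfl := key 1 h1; rfl
  · obtain rfl := key 2 h2; rfl
  · exfalso
    fin_cases j
    exacts [h0 hq, h1 hq, h2 hq]

variable (k) in
/-- **The source of the gluing**: points of the `a`-th copy lying in a plumbing domain `D_j` of
a colour present at the vertex `2a`. [cite: Kosinski1993, VI.12 p. 120] -/
def glueSrc (c : ℝ) : Set (Quad (Tb k c)) :=
  {q | ∃ j, edgeA (Quad.idx q) j ∧ ((Quad.pt q : Tb k c) : (𝕊 k) × (𝕊 k)) ∈ dom k c j}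

variable (k) in
/-- **The target of the gluing** (the source of the inverse gluing). [cite: Kosinski1993, VI.12 p. 120] -/
def glueTgt (c : ℝ) : Set (Quad (Tb k c)) :=
  {q | ∃ j, edgeB (Quad.idx q) j ∧ ((Quad.pt q : Tb k c) : (𝕊 k) × (𝕊 k)) ∈ dom k c j}

/-- `mem_glueSrc` (mem glueSrc). [folklore] -/
theorem mem_glueSrc {q : Quad (Tb k c)} :
    q ∈ glueSrc k c ↔ ∃ j, edgeA (Quad.idx q) j ∧ ((Quad.pt q : Tb k c) : (𝕊 k) × (𝕊 k)) ∈ dom k c j := Iff.rfl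

/-- `mem_glueTgt` (mem glueTgt). [folklore] -/
theorem mem_glueTgt {q : Quad (Tb k c)} :
    q ∈ glueTgt k c ↔ ∃ j, edgeB (Quad.idx q) j ∧ ((Quad.pt q : Tb k c) : (𝕊 k) × (𝕊 k)) ∈ dom k c j := Iff.rfl

/-- The set of points of given copy-index and colour-domain is open. [folklore] -/
theorem isOpen_setOf_idx_mem {P : Fin 4 → Prop} (j : Fin 3) :
    IsOpen {q : Quad (Tb k c) | P (Quad.idx q) ∧ ((Quad.pt q : Tb k c) : (𝕊 k) × (𝕊 k)) ∈ dom k c j} := by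
  apply IsOpen.inter
  · exact (isOpen_discrete {a : Fin 4 | P a}).preimage Quad.continuous_idx
  · exact (isOpen_dom c j).preimage (continuous_subtype_val.comp Quad.continuous_pt)

/-- `isOpen_glueSrc` (isOpen glueSrc). [folklore] -/
theorem isOpen_glueSrc : IsOpen (glueSrc k c) := by
  have : glueSrc k c = ⋃ j, {q : Quad (Tb k c) | edgeA (Quad.idx q) j ∧
      ((Quad.pt q : Tb k c) : (𝕊 k) × (𝕊 k)) ∈ dom k c j} := by
    ext q; simp [glueSrc]
  rw [this]
  exact isOpen_iUnion fun j => isOpen_setOf_idx_mem (k := k) (c := c) (P := fun a => edgeA a j) j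

/-- `isOpen_glueTgt` (isOpen glueTgt). [folklore] -/
theorem isOpen_glueTgt : IsOpen (glueTgt k c) := by
  have : glueTgt k c = ⋃ j, {q : Quad (Tb k c) | edgeB (Quad.idx q) j ∧
      ((Quad.pt q : Tb k c) : (𝕊 k) × (𝕊 k)) ∈ dom k c j} := by
    ext q; simp [glueTgt]
  rw [this]
  exact isOpen_iUnion fun j => isOpen_setOf_idx_mem (k := k) (c := c) (P := fun a => edgeB a j) j

/-- `mapsTo_glueFun` (mapsTo glueFun). [folklore] -/
theorem mapsTo_glueFun (hk : 2 ≤ k) (hc : IsParam c) : MapsTo (glueFun hc) (glueSrc k c) (glueTgt k c) := by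
  rintro q ⟨j, hj, hq⟩
  rw [glueFun_eq hk hc hq]
  exact ⟨j, by simpa using edgeB_nbA _ _ hj, by simpa using pm_mem_dom hc hq⟩

/-- `mapsTo_unglueFun` (mapsTo unglueFun). [folklore] -/
theorem mapsTo_unglueFun (hk : 2 ≤ k) (hc : IsParam c) : MapsTo (unglueFun hc) (glueTgt k c) (glueSrc k c) := by
  rintro q ⟨j, hj, hq⟩
  rw [unglueFun_eq hk hc hq]
  exact ⟨j, by simpa using edgeA_nbB _ _ hj, by simpa using pm_mem_dom hc hq⟩

/-- `unglueFun_glueFun` (unglueFun glueFun). [folklore] -/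
theorem unglueFun_glueFun (hk : 2 ≤ k) (hc : IsParam c) {q : Quad (Tb k c)} (h : q ∈ glueSrc k c) :
    unglueFun hc (glueFun hc q) = q := by
  obtain ⟨j, hj, hq⟩ := h
  rw [glueFun_eq hk hc hq, unglueFun_eq hk hc (j := j) (by simpa using pm_mem_dom hc hq)]
  simp only [Quad.idx_mk, Quad.pt_mk, nbB_nbA _ _ hj, pm_pm hc hq, Quad.mk_idx_pt]

/-- `glueFun_unglueFun` (glueFun unglueFun). [folklore] -/
theorem glueFun_unglueFun (hk : 2 ≤ k) (hc : IsParam c) {q : Quad (Tb k c)} (h : q ∈ glueTgt k c) :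
    glueFun hc (unglueFun hc q) = q := by
  obtain ⟨j, hj, hq⟩ := h
  rw [unglueFun_eq hk hc hq, glueFun_eq hk hc (j := j) (by simpa using pm_mem_dom hc hq)]
  simp only [Quad.idx_mk, Quad.pt_mk, nbA_nbB _ _ hj, pm_pm hc hq, Quad.mk_idx_pt]

/-- Near a point of the `a`-th copy in `D_j`, the gluing map is `mk (nbA a j) ∘ pm j ∘ pt`.
[folklore] -/
theorem glueFun_eventuallyEq (hk : 2 ≤ k) (hc : IsParam c) {j : Fin 3} {q₀ : Quad (Tb k c)}
    (hq₀ : ((Quad.pt q₀ : Tb k c) : (𝕊 k) × (𝕊 k)) ∈ dom k c j) :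
    glueFun hc =ᶠ[𝓝 q₀] fun q => Quad.mk (nbA (Quad.idx q₀) j) (pm hc j (Quad.pt q)) := by
  filter_upwards [(isOpen_setOf_idx_mem (P := fun a => a = Quad.idx q₀) j).mem_nhds ⟨rfl, hq₀⟩] with q hq
  rw [glueFun_eq hk hc hq.2, hq.1]

/-- `unglueFun_eventuallyEq` (unglueFun eventuallyEq). [folklore] -/
theorem unglueFun_eventuallyEq (hk : 2 ≤ k) (hc : IsParam c) {j : Fin 3} {q₀ : Quad (Tb k c)}
    (hq₀ : ((Quad.pt q₀ : Tb k c) : (𝕊 k) × (𝕊 k)) ∈ dom k c j) :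
    unglueFun hc =ᶠ[𝓝 q₀] fun q => Quad.mk (nbB (Quad.idx q₀) j) (pm hc j (Quad.pt q)) := by
  filter_upwards [(isOpen_setOf_idx_mem (P := fun a => a = Quad.idx q₀) j).mem_nhds ⟨rfl, hq₀⟩] with q hq
  rw [unglueFun_eq hk hc hq.2, hq.1]

/-- `continuousAt_glueFun` (continuousAt glueFun). [folklore] -/
theorem continuousAt_glueFun (hk : 2 ≤ k) (hc : IsParam c) {j : Fin 3} {q₀ : Quad (Tb k c)}
    (hq₀ : ((Quad.pt q₀ : Tb k c) : (𝕊 k) × (𝕊 k)) ∈ dom k c j) : ContinuousAt (glueFun hc) q₀ := by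
  refine ContinuousAt.congr ?_ (glueFun_eventuallyEq hk hc hq₀).symm
  exact (Quad.continuous_mk _).continuousAt.comp
    ((continuousAt_pm hc hq₀).comp Quad.continuous_pt.continuousAt)

/-- `continuousAt_unglueFun` (continuousAt unglueFun). [folklore] -/
theorem continuousAt_unglueFun (hk : 2 ≤ k) (hc : IsParam c) {j : Fin 3} {q₀ : Quad (Tb k c)}
    (hq₀ : ((Quad.pt q₀ : Tb k c) : (𝕊 k) × (𝕊 k)) ∈ dom k c j) : ContinuousAt (unglueFun hc) q₀ := by
  refine ContinuousAt.congr ?_ (unglueFun_eventuallyEq hk hc hq₀).symm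
  exact (Quad.continuous_mk _).continuousAt.comp
    ((continuousAt_pm hc hq₀).comp Quad.continuous_pt.continuousAt)

/-- `contMDiffAt_glueFun` (contMDiffAt glueFun). [folklore] -/
theorem contMDiffAt_glueFun (hk : 2 ≤ k) (hc : IsParam c) {j : Fin 3} {q₀ : Quad (Tb k c)}
    (hq₀ : ((Quad.pt q₀ : Tb k c) : (𝕊 k) × (𝕊 k)) ∈ dom k c j) :
    ContMDiffAt ((𝓡 k).prod (𝓡 k)) ((𝓡 k).prod (𝓡 k)) ∞ (glueFun hc) q₀ := by
  refine ContMDiffAt.congr_of_eventuallyEq ?_ (glueFun_eventuallyEq hk hc hq₀)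
  exact (Quad.contMDiff_mk _).contMDiffAt.comp q₀
    ((contMDiffAt_pm hc hq₀).comp q₀ Quad.contMDiff_pt.contMDiffAt)

/-- `contMDiffAt_unglueFun` (contMDiffAt unglueFun). [folklore] -/
theorem contMDiffAt_unglueFun (hk : 2 ≤ k) (hc : IsParam c) {j : Fin 3} {q₀ : Quad (Tb k c)}
    (hq₀ : ((Quad.pt q₀ : Tb k c) : (𝕊 k) × (𝕊 k)) ∈ dom k c j) :
    ContMDiffAt ((𝓡 k).prod (𝓡 k)) ((𝓡 k).prod (𝓡 k)) ∞ (unglueFun hc) q₀ := by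
  refine ContMDiffAt.congr_of_eventuallyEq ?_ (unglueFun_eventuallyEq hk hc hq₀)
  exact (Quad.contMDiff_mk _).contMDiffAt.comp q₀
    ((contMDiffAt_pm hc hq₀).comp q₀ Quad.contMDiff_pt.contMDiffAt)

/-- **The gluing partial homeomorphism** `A = Quad N ⇀ B = Quad N` of the `E₈` plumbing.
[cite: Kosinski1993, VI.12 pp. 120–122] -/
def gluePH (hk : 2 ≤ k) (hc : IsParam c) : OpenPartialHomeomorph (Quad (Tb k c)) (Quad (Tb k c)) where
  toFun := glueFun hc
  invFun := unglueFun hc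
  source := glueSrc k c
  target := glueTgt k c
  map_source' := mapsTo_glueFun hk hc
  map_target' := mapsTo_unglueFun hk hc
  left_inv' := fun _ hq => unglueFun_glueFun hk hc hq
  right_inv' := fun _ hq => glueFun_unglueFun hk hc hq
  open_source := isOpen_glueSrc
  open_target := isOpen_glueTgt
  continuousOn_toFun := fun _ ⟨_, _, hq⟩ => (continuousAt_glueFun hk hc hq).continuousWithinAt
  continuousOn_invFun := fun _ ⟨_, _, hq⟩ => (continuousAt_unglueFun hk hc hq).continuousWithinAt

/-- `gluePH` as a function. [folklore] -/
@[simp] theorem coe_gluePH (hk : 2 ≤ k) (hc : IsParam c) :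
    (gluePH hk hc : Quad (Tb k c) → Quad (Tb k c)) = glueFun hc := rfl

/-- The inverse of `gluePH` as a function. [folklore] -/
@[simp] theorem coe_gluePH_symm (hk : 2 ≤ k) (hc : IsParam c) :
    ((gluePH hk hc).symm : Quad (Tb k c) → Quad (Tb k c)) = unglueFun hc := rfl

/-- The source of `gluePH`. [folklore] -/
@[simp] theorem gluePH_source (hk : 2 ≤ k) (hc : IsParam c) : (gluePH hk hc).source = glueSrc k c := rfl

/-- The target of `gluePH`. [folklore] -/
@[simp] theorem gluePH_target (hk : 2 ≤ k) (hc : IsParam c) : (gluePH hk hc).target = glueTgt k c := rfl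

/-- The gluing partial homeomorphism is smooth on its source. [cite: Kosinski1993, VI.12 p. 120] -/
theorem contMDiffOn_gluePH (hk : 2 ≤ k) (hc : IsParam c) :
    ContMDiffOn ((𝓡 k).prod (𝓡 k)) ((𝓡 k).prod (𝓡 k)) ∞ (gluePH hk hc) (gluePH hk hc).source :=
  fun _ ⟨_, _, hq⟩ => (contMDiffAt_glueFun hk hc hq).contMDiffWithinAt

/-- `contMDiffOn_gluePH_symm` (contMDiffOn gluePH symm). [folklore] -/
theorem contMDiffOn_gluePH_symm (hk : 2 ≤ k) (hc : IsParam c) :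
    ContMDiffOn ((𝓡 k).prod (𝓡 k)) ((𝓡 k).prod (𝓡 k)) ∞ (gluePH hk hc).symm (gluePH hk hc).target :=
  fun _ ⟨_, _, hq⟩ => (contMDiffAt_unglueFun hk hc hq).contMDiffWithinAt

end Glue

/-! ### §6 The open `E₈` plumbing -/

section Plumbed

variable {k : ℕ} {c : ℝ} {n : ℕ}

/-- **The gluing datum of the `E₈` plumbing**: `A = B = Quad N` (four tubes each), glued along
`gluePH`, both modelled on `ℝᵏ × ℝᵏ ≃L ℝⁿ⁺¹` (`k + k = n + 1`). [cite: Kosinski1993, VI.12 pp. 120–122] -/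
def glueData (hk : 2 ≤ k) (hc : IsParam c) (hkn : k + k = n + 1) :
    SmoothGlueData ((𝓡 k).prod (𝓡 k)) ((𝓡 k).prod (𝓡 k)) (Quad (Tb k c)) (Quad (Tb k c)) (𝔼 (n + 1)) where
  glue := gluePH hk hc
  contMDiffOn_glue := contMDiffOn_gluePH hk hc
  contMDiffOn_glue_symm := contMDiffOn_gluePH_symm hk hc
  linA := SphereProd.tubeModelLin k n hkn
  linB := SphereProd.tubeModelLin k n hkn

/-- The closed pieces `F_j = {(x, y) | ⟪x₁, e_j⟫ ≥ 0, y = plumbMap e_j x}` of `N × N` whose images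
make up the graph of the gluing. [folklore] -/
def graphPiece (k : ℕ) (c : ℝ) (j : Fin 3) : Set (Tb k c × Tb k c) :=
  {xy | 0 ≤ baseHt (pole k j.val) (xy.1 : (𝕊 k) × (𝕊 k)) ∧
    ((xy.2 : Tb k c) : (𝕊 k) × (𝕊 k)) = plumbMap (pole k j.val) (xy.1 : (𝕊 k) × (𝕊 k))}

/-- `F_j` is closed: `plumbMap e_j` is continuous where `⟪x₁, e_j⟫ ≥ 0` (and `⟪x₁, x₂⟫ > c ≥ 0`).
[folklore] -/
theorem isClosed_graphPiece (hc : IsParam c) (j : Fin 3) : IsClosed (graphPiece k c j) := by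
  have hC : IsClosed {xy : Tb k c × Tb k c | 0 ≤ baseHt (pole k j.val) (xy.1 : (𝕊 k) × (𝕊 k))} :=
    isClosed_le continuous_const ((continuous_baseHt _).comp (continuous_subtype_val.comp continuous_fst))
  have hΦ : ContinuousOn (fun xy : Tb k c × Tb k c =>
      (plumbMap (pole k j.val) (xy.1 : (𝕊 k) × (𝕊 k)), ((xy.2 : Tb k c) : (𝕊 k) × (𝕊 k))))
      {xy | 0 ≤ baseHt (pole k j.val) (xy.1 : (𝕊 k) × (𝕊 k))} := by
    refine ContinuousOn.prodMk ?_ (continuous_subtype_val.comp continuous_snd).continuousOn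
    refine (continuousOn_plumbMap _).comp (continuous_subtype_val.comp continuous_fst).continuousOn ?_
    intro xy hxy
    exact ⟨lt_of_lt_of_le (by norm_num) hxy, lt_of_le_of_lt hc.neg_one_le (lt_fibHt_coe xy.1)⟩
  have h := hΦ.preimage_isClosed_of_isClosed hC isClosed_diagonal
  convert h using 1
  ext xy
  simp only [graphPiece, mem_setOf_eq, mem_inter_iff, mem_preimage, mem_diagonal_iff]
  constructor
  · rintro ⟨h1, h2⟩; exact ⟨h1, h2.symm⟩
  · rintro ⟨h1, h2⟩; exact ⟨h1, h2.symm⟩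

/-- Points of `F_j` have first coordinate in `D_j` (`⟪x₁, e_j⟫ = ⟪y₁, y₂⟫ > c`). [folklore] -/
theorem mem_dom_of_mem_graphPiece (hc : IsParam c) {j : Fin 3} {xy : Tb k c × Tb k c}
    (h : xy ∈ graphPiece k c j) : (xy.1 : (𝕊 k) × (𝕊 k)) ∈ dom k c j := by
  obtain ⟨h1, h2⟩ := h
  have hb : -1 < baseHt (pole k j.val) (xy.1 : (𝕊 k) × (𝕊 k)) := lt_of_lt_of_le (by norm_num) h1
  have hf : -1 < fibHt (xy.1 : (𝕊 k) × (𝕊 k)) := lt_of_le_of_lt hc.neg_one_le (lt_fibHt_coe xy.1)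
  refine ⟨?_, lt_fibHt_coe xy.1⟩
  have := fibHt_plumbMap (pole k j.val) hb hf
  rw [← h2] at this
  rw [← this]
  exact lt_fibHt_coe xy.2

/-- **The graph of the gluing is a finite union of images of the closed pieces `F_j`.**
[folklore] -/
theorem graph_eq (hk : 2 ≤ k) (hc : IsParam c) :
    {p : Quad (Tb k c) × Quad (Tb k c) | p.1 ∈ glueSrc k c ∧ glueFun hc p.1 = p.2} =
      ⋃ aj ∈ {aj : Fin 4 × Fin 3 | edgeA aj.1 aj.2},
        (Prod.map (Quad.mk aj.1) (Quad.mk (nbA aj.1 aj.2))) '' graphPiece k c aj.2 := by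
  ext ⟨q, q'⟩
  simp only [mem_setOf_eq, mem_iUnion, mem_image, exists_prop]
  constructor
  · rintro ⟨⟨j, hj, hq⟩, hglue⟩
    rw [glueFun_eq hk hc hq] at hglue
    refine ⟨(Quad.idx q, j), hj, (Quad.pt q, pm hc j (Quad.pt q)),
      ⟨hc.nonneg.trans hq.1.le, coe_pm_of_mem hc hq⟩, ?_⟩
    exact Prod.ext (Quad.mk_idx_pt q) hglue
  · rintro ⟨⟨a, j⟩, hj, ⟨x, y⟩, hxy, hmap⟩
    simp only [Prod.map_apply, Prod.mk.injEq] at hmap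
    obtain ⟨rfl, rfl⟩ := hmap
    have hx : (x : (𝕊 k) × (𝕊 k)) ∈ dom k c j := mem_dom_of_mem_graphPiece hc hxy
    refine ⟨⟨j, by simpa using hj, by simpa using hx⟩, ?_⟩
    rw [glueFun_eq hk hc (j := j) (by simpa using hx)]
    simp only [Quad.idx_mk, Quad.pt_mk]
    congr 1
    exact Subtype.ext (by rw [coe_pm_of_mem hc hx]; exact hxy.2.symm)

/-- **The graph of the gluing is closed.** [folklore] -/
theorem isClosed_graph (hk : 2 ≤ k) (hc : IsParam c) :
    IsClosed {p : Quad (Tb k c) × Quad (Tb k c) | p.1 ∈ glueSrc k c ∧ glueFun hc p.1 = p.2} := by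
  rw [graph_eq hk hc]
  refine Set.Finite.isClosed_biUnion (Set.toFinite _) fun aj _ => ?_
  exact ((Quad.isClosedEmbedding_mk aj.1).prodMap (Quad.isClosedEmbedding_mk _)).isClosedMap _
    (isClosed_graphPiece hc aj.2)

variable (k c) in
/-- **The open `E₈` plumbing** `PV`: eight open tubes of the diagonal of `Sᵏ × Sᵏ` (open disc
bundles of `TSᵏ`) plumbed along the `E₈` tree (Kosinski 1993, VI.12: `M(4n)` is a compact
codimension-`0` submanifold of it, cut out in the sequel). A `C^∞` manifold modelled on `ℝⁿ⁺¹`,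
`n + 1 = 2k`. [cite: Kosinski1993, VI.12 pp. 120–122] -/
def PV (hk : 2 ≤ k) (hc : IsParam c) (hkn : k + k = n + 1) : Type :=
  (glueData hk hc hkn).Glued

variable (hk : 2 ≤ k) (hc : IsParam c) (hkn : k + k = n + 1)

/-- `instance` (instance). [folklore] -/
instance : TopologicalSpace (PV k c hk hc hkn) := inferInstanceAs (TopologicalSpace (glueData hk hc hkn).Glued)

/-- `instance` (instance). [folklore] -/
instance : ChartedSpace (𝔼 (n + 1)) (PV k c hk hc hkn) :=
  inferInstanceAs (ChartedSpace (𝔼 (n + 1)) (glueData hk hc hkn).Glued)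

/-- `instance` (instance). [folklore] -/
instance : IsManifold (𝓡 (n + 1)) ∞ (PV k c hk hc hkn) :=
  inferInstanceAs (IsManifold 𝓘(ℝ, 𝔼 (n + 1)) ∞ (glueData hk hc hkn).Glued)

/-- **The plumbing is Hausdorff** (closed graph). [cite: Kosinski1993, VI.12 pp. 120–122] -/
instance : T2Space (PV k c hk hc hkn) :=
  (glueData hk hc hkn).t2Space_of_isClosed_graph (isClosed_graph hk hc)

/-- The tube is σ-compact (an open subset of the compact metric space `Sᵏ × Sᵏ`). [folklore] -/
instance : SigmaCompactSpace (Tb k c) := by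
  haveI : LocallyCompactSpace (Tb k c) := (Tb k c).2.locallyCompactSpace
  infer_instance

/-- The glued space is σ-compact (images of two σ-compact spaces). [folklore] -/
theorem sigmaCompactSpace_glued : SigmaCompactSpace (glueData hk hc hkn).Glued := by
  rw [← isSigmaCompact_univ_iff, ← (glueData hk hc hkn).range_inl_union_range_inr, union_eq_iUnion]
  refine isSigmaCompact_iUnion _ fun b => ?_
  cases b
  · exact isSigmaCompact_range (glueData hk hc hkn).continuous_inr
  · exact isSigmaCompact_range (glueData hk hc hkn).continuous_inl

/-- The plumbing is σ-compact. [folklore] -/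
instance : SigmaCompactSpace (PV k c hk hc hkn) := sigmaCompactSpace_glued hk hc hkn

/-- **The plumbing is second countable.** [folklore] -/
instance : SecondCountableTopology (PV k c hk hc hkn) := by
  haveI := sigmaCompactSpace_glued hk hc hkn
  exact (glueData hk hc hkn).secondCountableTopology

/-! ### §7 The eight tubes inside the plumbing and the identification rule -/

/-- The `a`-th `A`-tube in the plumbing (vertex `2a`). [cite: Kosinski1993, VI.12 pp. 120–122] -/
def ιA (a : Fin 4) (x : Tb k c) : PV k c hk hc hkn := (glueData hk hc hkn).inl (Quad.mk a x)

/-- The `b`-th `B`-tube in the plumbing (vertex `2b + 1`). [cite: Kosinski1993, VI.12 pp. 120–122] -/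
def ιB (b : Fin 4) (x : Tb k c) : PV k c hk hc hkn := (glueData hk hc hkn).inr (Quad.mk b x)

/-- **The `v`-th tube of the `E₈` plumbing** (`v : Fin 8`, Kosinski's presentation sphere
`Σ_{v+1}` with its tubular neighbourhood): the open embedding `N → PV`. [cite: Kosinski1993, VI.12 pp. 120–122] -/
def ι (v : Fin 8) : Tb k c → PV k c hk hc hkn :=
  match v with
  | 0 => ιA hk hc hkn 0
  | 1 => ιB hk hc hkn 0
  | 2 => ιA hk hc hkn 1
  | 3 => ιB hk hc hkn 1
  | 4 => ιA hk hc hkn 2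
  | 5 => ιB hk hc hkn 2
  | 6 => ιA hk hc hkn 3
  | 7 => ιB hk hc hkn 3

/-- `theorem` (theorem). [folklore] -/
@[simp] theorem ι_vA (a : Fin 4) : ι hk hc hkn (vA a) = ιA hk hc hkn a := by
  fin_cases a <;> rfl

/-- `theorem` (theorem). [folklore] -/
@[simp] theorem ι_vB (b : Fin 4) : ι hk hc hkn (vB b) = ιB hk hc hkn b := by
  fin_cases b <;> rfl

/-- `isOpenEmbedding_` (isOpenEmbedding ). [folklore] -/
theorem isOpenEmbedding_ιA (a : Fin 4) : Topology.IsOpenEmbedding (ιA hk hc hkn a) :=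
  (glueData hk hc hkn).isOpenEmbedding_inl.comp (Quad.isOpenEmbedding_mk a)

/-- `isOpenEmbedding_` (isOpenEmbedding ). [folklore] -/
theorem isOpenEmbedding_ιB (b : Fin 4) : Topology.IsOpenEmbedding (ιB hk hc hkn b) :=
  (glueData hk hc hkn).isOpenEmbedding_inr.comp (Quad.isOpenEmbedding_mk b)

/-- **Each tube is openly embedded in the plumbing.** [cite: Kosinski1993, VI.12 pp. 120–122] -/
theorem isOpenEmbedding_ι (v : Fin 8) : Topology.IsOpenEmbedding (ι hk hc hkn v) := by
  rcases exists_vA_or_vB v with ⟨a, rfl⟩ | ⟨b, rfl⟩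
  · rw [ι_vA]; exact isOpenEmbedding_ιA hk hc hkn a
  · rw [ι_vB]; exact isOpenEmbedding_ιB hk hc hkn b

/-- `continuous_` (continuous ). [folklore] -/
theorem continuous_ι (v : Fin 8) : Continuous (ι hk hc hkn v) := (isOpenEmbedding_ι hk hc hkn v).continuous

/-- `injective_` (injective ). [folklore] -/
theorem injective_ι (v : Fin 8) : Injective (ι hk hc hkn v) := (isOpenEmbedding_ι hk hc hkn v).injective

/-- `isOpen_range_` (isOpen range ). [folklore] -/
theorem isOpen_range_ι (v : Fin 8) : IsOpen (range (ι hk hc hkn v)) :=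
  (isOpenEmbedding_ι hk hc hkn v).isOpen_range

/-- `isOpenMap_` (isOpenMap ). [folklore] -/
theorem isOpenMap_ι (v : Fin 8) : IsOpenMap (ι hk hc hkn v) := (isOpenEmbedding_ι hk hc hkn v).isOpenMap

/-- `contMDiff_` (contMDiff ). [folklore] -/
theorem contMDiff_ιA (a : Fin 4) : ContMDiff ((𝓡 k).prod (𝓡 k)) (𝓡 (n + 1)) ∞ (ιA hk hc hkn a) :=
  (glueData hk hc hkn).contMDiff_inl.comp (Quad.contMDiff_mk a)

/-- `contMDiff_` (contMDiff ). [folklore] -/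
theorem contMDiff_ιB (b : Fin 4) : ContMDiff ((𝓡 k).prod (𝓡 k)) (𝓡 (n + 1)) ∞ (ιB hk hc hkn b) :=
  (glueData hk hc hkn).contMDiff_inr.comp (Quad.contMDiff_mk b)

/-- **Each tube is smoothly embedded in the plumbing.** [cite: Kosinski1993, VI.12 pp. 120–122] -/
theorem contMDiff_ι (v : Fin 8) : ContMDiff ((𝓡 k).prod (𝓡 k)) (𝓡 (n + 1)) ∞ (ι hk hc hkn v) := by
  rcases exists_vA_or_vB v with ⟨a, rfl⟩ | ⟨b, rfl⟩
  · rw [ι_vA]; exact contMDiff_ιA hk hc hkn a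
  · rw [ι_vB]; exact contMDiff_ιB hk hc hkn b

/-- Every point of the plumbing lies in one of the eight tubes. [folklore] -/
theorem exists_ι_eq (p : PV k c hk hc hkn) : ∃ v x, ι hk hc hkn v x = p := by
  rcases (glueData hk hc hkn).exists_inl_or_inr p with ⟨q, rfl⟩ | ⟨q, rfl⟩
  · obtain ⟨a, x, rfl⟩ := Quad.exists_eq_mk q
    exact ⟨vA a, x, by rw [ι_vA]; rfl⟩
  · obtain ⟨b, x, rfl⟩ := Quad.exists_eq_mk q
    exact ⟨vB b, x, by rw [ι_vB]; rfl⟩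

/-- The eight tubes cover the plumbing. [folklore] -/
theorem iUnion_range_ι : ⋃ v, range (ι hk hc hkn v) = univ := by
  refine eq_univ_of_forall fun p => ?_
  obtain ⟨v, x, rfl⟩ := exists_ι_eq hk hc hkn p
  exact mem_iUnion.2 ⟨v, mem_range_self x⟩

/-- The identification rule across the gluing, `A`-side to `B`-side. [folklore] -/
theorem ιA_eq_ιB_iff {a b : Fin 4} {x y : Tb k c} :
    ιA hk hc hkn a x = ιB hk hc hkn b y ↔
      ∃ j, edgeA a j ∧ (x : (𝕊 k) × (𝕊 k)) ∈ dom k c j ∧ nbA a j = b ∧ pm hc j x = y := by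
  change (glueData hk hc hkn).inl _ = (glueData hk hc hkn).inr _ ↔ _
  rw [(glueData hk hc hkn).inl_eq_inr_iff]
  change Quad.mk a x ∈ glueSrc k c ∧ glueFun hc (Quad.mk a x) = Quad.mk b y ↔ _
  constructor
  · rintro ⟨⟨j, hj, hx⟩, hglue⟩
    rw [glueFun_eq hk hc hx] at hglue
    simp only [Quad.idx_mk, Quad.pt_mk, Quad.mk_eq_mk_iff] at hj hx hglue
    exact ⟨j, hj, hx, hglue.1, hglue.2⟩
  · rintro ⟨j, hj, hx, rfl, rfl⟩
    refine ⟨⟨j, by simpa using hj, by simpa using hx⟩, ?_⟩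
    rw [glueFun_eq hk hc (j := j) (by simpa using hx)]
    simp

/-- **The identification rule of the plumbing**: `ι v x = ι w y` iff `v = w` and `x = y`, or
`{v, w}` is an edge of the `E₈` tree (`Γ₈(v, w) = 1`), `x` lies in the plumbing domain of the
colour of that edge and `y = plumbMap e x`. [cite: Kosinski1993, VI.12 pp. 120–122] -/
theorem ι_eq_ι_iff {v w : Fin 8} {x y : Tb k c} :
    ι hk hc hkn v x = ι hk hc hkn w y ↔
      (v = w ∧ x = y) ∨ (kosinskiGamma8 v w = 1 ∧ (x : (𝕊 k) × (𝕊 k)) ∈ dom k c (ecol v w) ∧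
        y = pm hc (ecol v w) x) := by
  rcases exists_vA_or_vB v with ⟨a, rfl⟩ | ⟨b, rfl⟩ <;>
    rcases exists_vA_or_vB w with ⟨a', rfl⟩ | ⟨b', rfl⟩
  · -- A / A
    rw [ι_vA, ι_vA]
    constructor
    · intro h
      have h' := Quad.mk_eq_mk_iff.1 ((glueData hk hc hkn).inl_injective h)
      exact Or.inl ⟨by rw [h'.1], h'.2⟩
    · rintro (⟨h1, rfl⟩ | ⟨h1, -, -⟩)
      · rw [vA_injective h1]
      · exact absurd h1 (gamma8_vA_vA_ne_one a a')
  · -- A / B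
    rw [ι_vA, ι_vB, ιA_eq_ιB_iff]
    constructor
    · rintro ⟨j, hj, hx, rfl, rfl⟩
      refine Or.inr ⟨(gamma8_vA_vB_eq_one_iff a _).2 ⟨j, hj, rfl⟩, ?_, ?_⟩
      · rw [ecol_vA_nbA a j hj]; exact hx
      · rw [ecol_vA_nbA a j hj]
    · rintro (⟨h1, -⟩ | ⟨h1, hx, rfl⟩)
      · exact absurd h1 (vA_ne_vB a b')
      · obtain ⟨j, hj, rfl⟩ := (gamma8_vA_vB_eq_one_iff a b').1 h1
        rw [ecol_vA_nbA a j hj] at hx ⊢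
        exact ⟨j, hj, hx, rfl, rfl⟩
  · -- B / A
    rw [ι_vB, ι_vA, eq_comm, ιA_eq_ιB_iff, gamma8_vB_vA, ecol_comm]
    constructor
    · rintro ⟨j, hj, hy, rfl, rfl⟩
      refine Or.inr ⟨(gamma8_vA_vB_eq_one_iff a' _).2 ⟨j, hj, rfl⟩, ?_, ?_⟩
      · rw [ecol_vA_nbA a' j hj]; exact pm_mem_dom hc hy
      · rw [ecol_vA_nbA a' j hj, pm_pm hc hy]
    · rintro (⟨h1, -⟩ | ⟨h1, hx, rfl⟩)
      · exact absurd h1.symm (vA_ne_vB a' b)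
      · obtain ⟨j, hj, rfl⟩ := (gamma8_vA_vB_eq_one_iff a' b).1 h1
        rw [ecol_vA_nbA a' j hj] at hx ⊢
        exact ⟨j, hj, pm_mem_dom hc hx, rfl, pm_pm hc hx⟩
  · -- B / B
    rw [ι_vB, ι_vB]
    constructor
    · intro h
      have h' := Quad.mk_eq_mk_iff.1 ((glueData hk hc hkn).inr_injective h)
      exact Or.inl ⟨by rw [h'.1], h'.2⟩
    · rintro (⟨h1, rfl⟩ | ⟨h1, -, -⟩)
      · rw [vB_injective h1]
      · exact absurd h1 (gamma8_vB_vB_ne_one b b')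

/-- Distinct non-adjacent tubes are disjoint in the plumbing. [cite: Kosinski1993, VI.12 pp. 120–122] -/
theorem disjoint_range_ι {v w : Fin 8} (hvw : v ≠ w) (h : kosinskiGamma8 v w ≠ 1) :
    Disjoint (range (ι hk hc hkn v)) (range (ι hk hc hkn w)) := by
  rw [Set.disjoint_left]
  rintro _ ⟨x, rfl⟩ ⟨y, hy⟩
  rcases (ι_eq_ι_iff hk hc hkn).1 hy.symm with ⟨h1, -⟩ | ⟨h1, -, -⟩
  · exact hvw h1
  · exact h h1

/-! #### Maps out of the plumbing -/

section Desc

variable {Z : Type*}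

/-- **Descent**: maps on the eight tubes which agree across the seven plumbings define a map on
the plumbing. [folklore] -/
def desc (f : Fin 8 → Tb k c → Z)
    (hf : ∀ v w (x : Tb k c), kosinskiGamma8 v w = 1 → (x : (𝕊 k) × (𝕊 k)) ∈ dom k c (ecol v w) →
      f v x = f w (pm hc (ecol v w) x)) : PV k c hk hc hkn → Z :=
  (glueData hk hc hkn).desc (fun q => f (vA (Quad.idx q)) (Quad.pt q)) (fun q => f (vB (Quad.idx q)) (Quad.pt q))
    (by
      rintro q ⟨j, hj, hq⟩
      change f (vA (Quad.idx q)) (Quad.pt q) = f (vB (Quad.idx (glueFun hc q))) (Quad.pt (glueFun hc q))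
      rw [glueFun_eq hk hc hq, Quad.idx_mk, Quad.pt_mk]
      have h1 := (gamma8_vA_vB_eq_one_iff (Quad.idx q) _).2 ⟨j, hj, rfl⟩
      have h2 := hf _ _ (Quad.pt q) h1
      rw [ecol_vA_nbA _ j hj] at h2
      exact h2 hq)

/-- The descended map restricts to the given maps on the tubes. [folklore] -/
@[simp] theorem desc_ι (f : Fin 8 → Tb k c → Z)
    (hf : ∀ v w (x : Tb k c), kosinskiGamma8 v w = 1 → (x : (𝕊 k) × (𝕊 k)) ∈ dom k c (ecol v w) →
      f v x = f w (pm hc (ecol v w) x)) (v : Fin 8) (x : Tb k c) :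
    desc hk hc hkn f hf (ι hk hc hkn v x) = f v x := by
  rcases exists_vA_or_vB v with ⟨a, rfl⟩ | ⟨b, rfl⟩
  · rw [ι_vA]
    change (glueData hk hc hkn).desc _ _ _ ((glueData hk hc hkn).inl _) = _
    rw [SmoothGlueData.desc_inl]; simp
  · rw [ι_vB]
    change (glueData hk hc hkn).desc _ _ _ ((glueData hk hc hkn).inr _) = _
    rw [SmoothGlueData.desc_inr]; simp

end Desc

section Maps

variable {EZ HZ : Type*} [NormedAddCommGroup EZ] [NormedSpace ℝ EZ] [TopologicalSpace HZ]
  {IZ : ModelWithCorners ℝ EZ HZ} {Z : Type*} [TopologicalSpace Z] [ChartedSpace HZ Z]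

/-- **A map out of the plumbing is smooth iff its eight restrictions to the tubes are.**
[folklore] -/
theorem contMDiff_iff_comp_ι {F : PV k c hk hc hkn → Z} :
    ContMDiff (𝓡 (n + 1)) IZ ∞ F ↔ ∀ v, ContMDiff ((𝓡 k).prod (𝓡 k)) IZ ∞ (F ∘ ι hk hc hkn v) := by
  have key := (glueData hk hc hkn).contMDiff_iff_comp_inl_inr (I' := IZ) (F := F)
  rw [Quad.contMDiff_iff_comp_mk, Quad.contMDiff_iff_comp_mk] at key
  refine key.trans ?_
  constructor
  · rintro ⟨hA, hB⟩ v
    rcases exists_vA_or_vB v with ⟨a, rfl⟩ | ⟨b, rfl⟩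
    · rw [ι_vA]; exact hA a
    · rw [ι_vB]; exact hB b
  · intro h
    refine ⟨fun a => ?_, fun b => ?_⟩
    · have := h (vA a); rwa [ι_vA] at this
    · have := h (vB b); rwa [ι_vB] at this

/-- A map out of the plumbing is continuous iff its eight restrictions are. [folklore] -/
theorem continuous_iff_comp_ι {Y : Type*} [TopologicalSpace Y] {F : PV k c hk hc hkn → Y} :
    Continuous F ↔ ∀ v, Continuous (F ∘ ι hk hc hkn v) := by
  constructor
  · intro h v; exact h.comp (continuous_ι hk hc hkn v)
  · intro h
    haveI := nonempty_Tb (k := k) hc.lt_one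
    rw [continuous_iff_continuousAt]
    intro p
    obtain ⟨v, x, rfl⟩ := exists_ι_eq hk hc hkn p
    have h1 : ContinuousAt (F ∘ ι hk hc hkn v ∘ (isOpenEmbedding_ι hk hc hkn v).toOpenPartialHomeomorph.symm)
        (ι hk hc hkn v x) := by
      refine (h v).continuousAt.comp ?_
      exact (isOpenEmbedding_ι hk hc hkn v).toOpenPartialHomeomorph.continuousAt_symm
        ((isOpenEmbedding_ι hk hc hkn v).toOpenPartialHomeomorph.map_source (mem_univ x))
    refine h1.congr ?_
    filter_upwards [(isOpen_range_ι hk hc hkn v).mem_nhds (mem_range_self x)] with p hp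
    obtain ⟨y, rfl⟩ := hp
    simp only [comp_apply]
    exact congrArg (F ∘ ι hk hc hkn v)
      ((isOpenEmbedding_ι hk hc hkn v).toOpenPartialHomeomorph.left_inv (mem_univ y))

/-- The descended map is smooth if the given maps are. [folklore] -/
theorem contMDiff_desc {f : Fin 8 → Tb k c → Z}
    (hf : ∀ v w (x : Tb k c), kosinskiGamma8 v w = 1 → (x : (𝕊 k) × (𝕊 k)) ∈ dom k c (ecol v w) →
      f v x = f w (pm hc (ecol v w) x)) (h : ∀ v, ContMDiff ((𝓡 k).prod (𝓡 k)) IZ ∞ (f v)) :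
    ContMDiff (𝓡 (n + 1)) IZ ∞ (desc hk hc hkn f hf) := by
  rw [contMDiff_iff_comp_ι]
  intro v
  have : desc hk hc hkn f hf ∘ ι hk hc hkn v = f v := funext fun x => desc_ι hk hc hkn f hf v x
  rw [this]; exact h v

/-- The descended map is continuous if the given maps are. [folklore] -/
theorem continuous_desc {Y : Type*} [TopologicalSpace Y] {f : Fin 8 → Tb k c → Y}
    (hf : ∀ v w (x : Tb k c), kosinskiGamma8 v w = 1 → (x : (𝕊 k) × (𝕊 k)) ∈ dom k c (ecol v w) →
      f v x = f w (pm hc (ecol v w) x)) (h : ∀ v, Continuous (f v)) :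
    Continuous (desc (Z := Y) hk hc hkn f hf) := by
  rw [continuous_iff_comp_ι]
  intro v
  have : desc hk hc hkn f hf ∘ ι hk hc hkn v = f v := funext fun x => desc_ι hk hc hkn f hf v x
  rw [this]; exact h v

end Maps

end Plumbed

end Plumbing

end Literature.Topology.FourManifolds
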